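import Summits.AnomalousDissipation.AnomalousDissipation.Theorems.MomentParityGalerkinBounds
import Summits.AnomalousDissipation.AnomalousDissipation.Theorems.MomentParityPathExt

/-!
# Route MomentParity · `GalerkinEnsembleRealization` — Galerkin orbits confined to the energy
  ball are paths of the trajectory space

For the level-`N` Galerkin semiflow `galerkinCoeffFlow ν g` (steady force coefficients `g`,
`‖ḡ k‖ ≤ A`): an orbit issued from the phase space which stays in the energy ball
`∑_{k∈S} ‖c̄ k‖² ≤ R²` is `pathLip ν A R k`-Lipschitz mode by mode (mean value inequality with
`norm_galerkinRHS_apply_le_pathLip`), so its coefficient path `orbitPath ν g c` belongs to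
`pathSpace R (pathLip ν A R)`; the orbit map is continuous on the phase space, intertwines the
time-one map with the shift, and its continuous-time extension is the orbit itself
(stmt-AnomalousDissipation-11466).
-/

noncomputable section

set_option linter.dupNamespace false

open MeasureTheory Set Filter Topology Function Metric
open scoped BigOperators

namespace Summit.AnomalousDissipation.AnomalousDissipation.Theorems.MomentParity

open Literature.Analysis.FunctionSpaces Literature.Analysis.FunctionSpaces.Torus
open Literature.Analysis.FluidPDE Literature.Analysis.FluidPDE.Torus

variable {d : Type*} [Fintype d] [DecidableEq d] {S : Finset (d → ℤ)} {ν : ℝ}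
  {g : ↥S → EuclideanSpace ℂ d}

/-! ### Lipschitz bound for confined orbits -/

/-- **Mode-by-mode Lipschitz bound for a confined Galerkin orbit**: if a global solution of the
Galerkin ODE stays in the energy ball `∑_{k∈S} ‖c̄ k‖² ≤ R²` for all `t ≥ 0` and `‖ḡ k‖ ≤ A`, then
`‖α(t) k - α(s) k‖ ≤ pathLip ν A R k · |t - s|` for `s, t ≥ 0` (mean value inequality). -/
theorem norm_apply_sub_le_of_isGalerkinODESolution {c₀ : ↥S → EuclideanSpace ℂ d}
    {α : ℝ → ↥S → EuclideanSpace ℂ d} (hα : IsGalerkinODESolution ν g c₀ α) {R A : ℝ}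
    (hconf : ∀ t, 0 ≤ t → ∑ k ∈ S, ‖coeffExt S (α t) k‖ ^ 2 ≤ R ^ 2)
    (hA : ∀ k, ‖coeffExt S g k‖ ≤ A) (k : ↥S) {s t : ℝ} (hs : 0 ≤ s) (ht : 0 ≤ t) :
    ‖α t k - α s k‖ ≤ pathLip ν A R (k : d → ℤ) * |t - s| := by
  -- reduce to `s ≤ t`
  wlog hst : s ≤ t generalizing s t
  · have h := this ht hs (le_of_not_ge hst)
    rwa [norm_sub_rev, abs_sub_comm] at h
  have hderiv : ∀ x ∈ Icc s t, HasDerivWithinAt (fun τ => α τ k) (galerkinRHS S ν g (α x) k) (Icc s t) x := by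
    intro x hx
    have h := (hα.hasDerivWithinAt t x ⟨hs.trans hx.1, hx.2⟩).mono (Icc_subset_Icc hs le_rfl)
    exact (hasDerivWithinAt_pi.1 h) k
  have hbound : ∀ x ∈ Ico s t, ‖galerkinRHS S ν g (α x) k‖ ≤ pathLip ν A R (k : d → ℤ) := fun x hx =>
    norm_galerkinRHS_apply_le_pathLip ν (hα.mem x) (hconf x (hs.trans hx.1)) hA k
  have h := norm_image_sub_le_of_norm_deriv_le_segment' hderiv hbound t (right_mem_Icc.2 hst)
  rwa [abs_of_nonneg (sub_nonneg.2 hst)]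

/-! ### Confined orbits are paths of the trajectory space -/

/-- **A confined orbit of the Galerkin semiflow is a path of the trajectory space**
`𝒦(R, pathLip ν A R)`: for `ν ≥ 0`, a symmetric `S`, real force coefficients with `‖ḡ k‖ ≤ A`,
`A ≥ 0`, and a datum `c` of the phase space whose orbit stays in the energy ball for all `t ≥ 0`. -/
theorem orbitPath_mem_pathSpace (hν : 0 ≤ ν) (hS : ∀ k ∈ S, -k ∈ S) (hg : IsRealCoeff g)
    {c : ↥S → EuclideanSpace ℂ d} (hc : c ∈ galerkinSubspace S) {R A : ℝ} (hA : ∀ k, ‖coeffExt S g k‖ ≤ A)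
    (hA0 : 0 ≤ A)
    (hconf : ∀ t, 0 ≤ t → ∑ k ∈ S, ‖coeffExt S (galerkinCoeffFlow ν g t c) k‖ ^ 2 ≤ R ^ 2) :
    orbitPath ν g c ∈ pathSpace R (pathLip ν A R) := by
  have hsol := isGalerkinODESolution_galerkinCoeffFlow hν hS hg hc
  have hmemV : ∀ t, galerkinCoeffFlow ν g t c ∈ galerkinSubspace S := fun t => galerkinCoeffFlow_mem hc t
  refine ⟨fun q k => ?_, fun q T => ?_, fun q q' k hq hq' => ?_, fun q => ?_, fun q k => ?_⟩
  · simp only [orbitPath_apply]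
    rw [max_eq_left (le_max_right q 0)]
  · simp only [orbitPath_apply]
    have hq : (0 : ℝ) ≤ ((max q 0 : ℚ) : ℝ) := by exact_mod_cast le_max_right q 0
    refine le_trans ?_ (hconf _ hq)
    -- restrict to `T ∩ S`: off `S` the extension vanishes
    rw [← Finset.sum_filter_add_sum_filter_not T (· ∈ S)]
    have h0 : ∑ k ∈ T.filter (· ∉ S), ‖coeffExt S (galerkinCoeffFlow ν g ((max q 0 : ℚ) : ℝ) c) k‖ ^ 2 = 0 :=
      Finset.sum_eq_zero fun k hk => by
        rw [coeffExt_of_not_mem _ (Finset.mem_filter.1 hk).2, norm_zero, zero_pow two_ne_zero]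
    rw [h0, add_zero]
    exact Finset.sum_le_sum_of_subset_of_nonneg (fun k hk => (Finset.mem_filter.1 hk).2)
      fun _ _ _ => sq_nonneg _
  · simp only [orbitPath_apply, max_eq_left hq, max_eq_left hq']
    by_cases hk : k ∈ S
    · rw [coeffExt_of_mem _ hk, coeffExt_of_mem _ hk]
      have h := norm_apply_sub_le_of_isGalerkinODESolution hsol hconf hA ⟨k, hk⟩ (s := (q' : ℝ)) (t := (q : ℝ))
        (by exact_mod_cast hq') (by exact_mod_cast hq)
      exact h
    · rw [coeffExt_of_not_mem _ hk, coeffExt_of_not_mem _ hk, sub_zero, norm_zero]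
      exact mul_nonneg (zero_le_one.trans (one_le_pathLip hA0 k)) (abs_nonneg _)
  · simp only [orbitPath_apply]
    exact (hmemV _).1.isConjSymm_coeffExt hS
  · simp only [orbitPath_apply]
    by_cases hk : k ∈ S
    · rw [coeffExt_of_mem _ hk]; exact (hmemV _).2 ⟨k, hk⟩
    · simp [coeffExt_of_not_mem _ hk]

/-! ### Continuity, the shift, and the extension of an orbit path -/

/-- **The orbit map is continuous on the phase space** (coordinatewise: continuous dependence of
the semiflow on the datum). -/
theorem continuousOn_orbitPath (hν : 0 ≤ ν) (hS : ∀ k ∈ S, -k ∈ S) (hg : IsRealCoeff g) :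
    ContinuousOn (orbitPath ν g) (galerkinSubspace S : Set (↥S → EuclideanSpace ℂ d)) := by
  refine continuousOn_pi.2 fun p => ?_
  have hq : (0 : ℝ) ≤ ((max p.1 0 : ℚ) : ℝ) := by exact_mod_cast le_max_right p.1 0
  have h1 : ContinuousOn (fun c => galerkinCoeffFlow ν g ((max p.1 0 : ℚ) : ℝ) c)
      (galerkinSubspace S : Set (↥S → EuclideanSpace ℂ d)) :=
    (continuousOn_galerkinCoeffFlow hν hS hg).comp (continuousOn_const.prodMk continuousOn_id)
      fun c hc => ⟨mem_Ici.2 hq, hc⟩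
  have h2 : Continuous fun v : ↥S → EuclideanSpace ℂ d => coeffExt S v p.2 := by
    by_cases hk : p.2 ∈ S
    · simp_rw [coeffExt_of_mem _ hk]; exact continuous_apply _
    · simp_rw [coeffExt_of_not_mem _ hk]; exact continuous_const
  exact h2.comp_continuousOn h1

/-- **The orbit map intertwines the time-one map with the shift**: `orbitPath (φ₁ c) = θ (orbitPath c)`
on the phase space (semigroup law). -/
theorem orbitPath_galerkinCoeffFlow_one (hν : 0 ≤ ν) (hS : ∀ k ∈ S, -k ∈ S) (hg : IsRealCoeff g)
    {c : ↥S → EuclideanSpace ℂ d} (hc : c ∈ galerkinSubspace S) :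
    orbitPath ν g (galerkinCoeffFlow ν g 1 c) = pathShift (orbitPath ν g c) := by
  funext p
  obtain ⟨q, k⟩ := p
  rw [orbitPath_apply, pathShift_apply, orbitPath_apply]
  have hq : (0 : ℝ) ≤ ((max q 0 : ℚ) : ℝ) := by exact_mod_cast le_max_right q 0
  have hmax : max (max q 0 + 1) 0 = max q 0 + 1 := max_eq_left (by positivity)
  rw [hmax, ← galerkinCoeffFlow_add hν hS hg hc hq zero_le_one]
  push_cast
  ring_nf

/-- **The extension of an orbit path is the orbit**: `(orbitPath c)‾(t, k) = (φ_t c)‾ k` for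
`t ≥ 0`, whenever the orbit path lies in a trajectory space (continuity of the orbit in time). -/
theorem pathExt_orbitPath (hν : 0 ≤ ν) (hS : ∀ k ∈ S, -k ∈ S) (hg : IsRealCoeff g)
    {c : ↥S → EuclideanSpace ℂ d} (hc : c ∈ galerkinSubspace S) {R : ℝ} {L : (d → ℤ) → ℝ}
    (hmem : orbitPath ν g c ∈ pathSpace R L) {t : ℝ} (ht : 0 ≤ t) (k : d → ℤ) :
    pathExt (orbitPath ν g c) t k = coeffExt S (galerkinCoeffFlow ν g t c) k := by
  have hsol := isGalerkinODESolution_galerkinCoeffFlow hν hS hg hc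
  have h1 := tendsto_dyadic_apply hmem t k
  -- the orbit is continuous in time, so along the dyadic times it tends to its value at `t`
  have hcont : ContinuousWithinAt (fun s => galerkinCoeffFlow ν g s c) (Ici 0) t :=
    hsol.continuousOn t (mem_Ici.2 ht)
  have hcoef : Continuous fun v : ↥S → EuclideanSpace ℂ d => coeffExt S v k := by
    by_cases hk : k ∈ S
    · simp_rw [coeffExt_of_mem _ hk]; exact continuous_apply _
    · simp_rw [coeffExt_of_not_mem _ hk]; exact continuous_const
  have hdy : Tendsto (fun n => ((dyadicFloor t n : ℚ) : ℝ)) atTop (𝓝[Ici 0] t) := by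
    refine tendsto_nhdsWithin_iff.2 ⟨?_, Eventually.of_forall fun n => ?_⟩
    · simpa [max_eq_left ht] using tendsto_dyadicFloor t
    · exact mem_Ici.2 (by exact_mod_cast dyadicFloor_nonneg t n)
  have h2 : Tendsto (fun n => coeffExt S (galerkinCoeffFlow ν g ((dyadicFloor t n : ℚ) : ℝ) c) k) atTop
      (𝓝 (coeffExt S (galerkinCoeffFlow ν g t c) k)) :=
    (hcoef.tendsto _).comp (hcont.tendsto.comp hdy)
  have heq : ∀ n, orbitPath ν g c (dyadicFloor t n, k) =
      coeffExt S (galerkinCoeffFlow ν g ((dyadicFloor t n : ℚ) : ℝ) c) k := fun n => by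
    rw [orbitPath_apply, max_eq_left (dyadicFloor_nonneg t n)]
  simp_rw [heq] at h1
  exact tendsto_nhds_unique h1 h2

end Summit.AnomalousDissipation.AnomalousDissipation.Theorems.MomentParity
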